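import Literature.RingTheory.CompleteLocalRings.WittVectorResidueDisc
import Literature.RingTheory.Smooth.PointDerivationOfRelativeDimension
import Mathlib.AlgebraicGeometry.Morphisms.Smooth
import HarnessLib

/-!
# Residue discs of smooth `W(κ)`-schemes of positive relative dimension are uncountable

Topic `Literature/RingTheory/CompleteLocalRings`. The geometric form of
`CompleteLocalRings.not_countable_lifts_wittVector` (Maulik–Poonen 2012, §4: the set of
`W`-points of a smooth `W`-scheme with given reduction is a `p`-adic disc of dimension the relative
dimension; Cassels 1976, proof of Thm. I): for an affine `W(κ)`-scheme `Spec A → Spec W(κ)` smooth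
of relative dimension `n ≥ 1` (Mathlib `AlgebraicGeometry.SmoothOfRelativeDimension`) and a
`κ`-point `x̄` over the closed point, the set of `W(κ)`-points `A →ₐ W(κ)` reducing to `x̄` is not
countable.

* `exists_isStandardSmoothOfRelativeDimension_away` — a morphism of affine schemes smooth of
  relative dimension `n` is STANDARD smooth of relative dimension `n` on a basic open around any
  given point (unpacking Mathlib's `HasRingHomProperty` / `RingHom.Locally`);
* `not_countable_lifts_wittVector_of_smoothOfRelativeDimension` — the statement above: on such a
  chart `Ω` is free of rank `n ≥ 1`, whence a non-zero point derivation
  (`Smooth.exists_pointDerivation_ne_zero`), and the chart is formally smooth, so the binary tree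
  of lifts of `not_countable_lifts_wittVector` applies; lifts of the chart restrict injectively to
  `A`.

## References

* [MaulikPoonen2012] D. Maulik, B. Poonen, Néron–Severi groups under specialization, Duke Math.
  J. 161 (2012), §4.
* [Cassels1976] J. W. S. Cassels, An embedding theorem for fields, Bull. Austral. Math. Soc. 14
  (1976), proof of Thm. I.
* The Stacks Project, Tag 00T7. [StacksProject]
-/

noncomputable section

universe u

namespace Literature.RingTheory.CompleteLocalRings

open AlgebraicGeometry Literature.RingTheory.Smooth

/-- **A standard smooth chart around a point.** If `Spec A → Spec R` is smooth of relative dimension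
`n` (Mathlib: locally standard smooth of relative dimension `n`) and `x : A → K` is a point with
values in a field, there is `t ∈ A` with `x(t) ≠ 0` such that `A[1/t]` is standard smooth of
relative dimension `n` over `R` (the charts of the definition cover `Spec A`; Stacks Project,
Tag 00T7). [cite: StacksProject, Tag 00TA] -/
theorem exists_isStandardSmoothOfRelativeDimension_away {R A : Type u} [CommRing R] [CommRing A]
    [Algebra R A] (n : ℕ)
    [h : SmoothOfRelativeDimension n (Spec.map (CommRingCat.ofHom (algebraMap R A)))]
    {K : Type*} [Field K] (x : A →+* K) :
    ∃ t : A, x t ≠ 0 ∧ Algebra.IsStandardSmoothOfRelativeDimension n R (Localization.Away t) := by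
  have hloc : RingHom.Locally (RingHom.IsStandardSmoothOfRelativeDimension n) (algebraMap R A) :=
    (HasRingHomProperty.Spec_iff (P := @SmoothOfRelativeDimension n)).mp h
  obtain ⟨s, hspan, hs⟩ := hloc
  -- some element of the covering family does not vanish at `x`
  obtain ⟨t, hts, hxt⟩ : ∃ t ∈ s, x t ≠ 0 := by
    by_contra H
    have hle : Ideal.span s ≤ RingHom.ker x := by
      rw [Ideal.span_le]
      intro t ht
      rw [SetLike.mem_coe, RingHom.mem_ker]
      by_contra hxt
      exact H ⟨t, ht, hxt⟩
    rw [hspan, top_le_iff] at hle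
    have h1 : (1 : A) ∈ RingHom.ker x := by rw [hle]; exact Submodule.mem_top
    rw [RingHom.mem_ker, map_one] at h1
    exact one_ne_zero h1
  refine ⟨t, hxt, ?_⟩
  have hst := hs t hts
  rw [← IsScalarTower.algebraMap_eq R A (Localization.Away t)] at hst
  exact (RingHom.isStandardSmoothOfRelativeDimension_algebraMap n).mp hst

/-- **Residue discs of smooth `W(κ)`-schemes of positive relative dimension are uncountable**
(Maulik–Poonen 2012, §4; Cassels 1976, proof of Thm. I). Let `κ` be a perfect field of
characteristic `p`, `A` a `W(κ)`-algebra with `Spec A → Spec W(κ)` smooth of relative dimension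
`n ≥ 1`, and `x̄ : A → κ` a `κ`-point over the closed point (`x̄ ∘ (W(κ) → A) = ` reduction). Then
the set of `W(κ)`-algebra maps `A → W(κ)` reducing to `x̄` is not countable. Proof: a standard smooth
chart `A[1/t] ∋ x̄` (`exists_isStandardSmoothOfRelativeDimension_away`) is formally smooth with a
non-zero point derivation at `x̄` (`Smooth.exists_pointDerivation_ne_zero`), so its lifts are
uncountable (`not_countable_lifts_wittVector`), and they restrict injectively to `A`.
[cite: MaulikPoonen2012, §4] -/
theorem not_countable_lifts_wittVector_of_smoothOfRelativeDimension {p : ℕ} [Fact p.Prime]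
    {κ : Type} [Field κ] [CharP κ p] [PerfectRing κ p] {A : Type} [CommRing A]
    [Algebra (WittVector p κ) A] (n : ℕ) (hn : 0 < n)
    [SmoothOfRelativeDimension n
      (Spec.map (CommRingCat.ofHom (algebraMap (WittVector p κ) A)))]
    (xbar : A →+* κ)
    (hx : ∀ w : WittVector p κ, xbar (algebraMap (WittVector p κ) A w) = WittVector.constantCoeff w) :
    ¬ Set.Countable {y : A →ₐ[WittVector p κ] WittVector p κ | ∀ a, (y a).coeff 0 = xbar a} := by
  set W := WittVector p κ with hW
  -- a standard smooth chart `L = A[1/t]` through `x̄`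
  obtain ⟨t, hxt, hL⟩ := exists_isStandardSmoothOfRelativeDimension_away (R := W) (A := A) n xbar
  set L := Localization.Away t with hLdef
  haveI := hL
  haveI : Algebra.IsStandardSmooth W L :=
    Algebra.IsStandardSmoothOfRelativeDimension.isStandardSmooth n
  haveI : Algebra.FormallySmooth W L := inferInstance
  -- the point and a non-zero point derivation on the chart
  let xL : L →+* κ := IsLocalization.Away.lift t (isUnit_iff_ne_zero.mpr hxt)
  have hxL : ∀ a : A, xL (algebraMap A L a) = xbar a :=
    fun a => IsLocalization.Away.lift_eq t (isUnit_iff_ne_zero.mpr hxt) a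
  have hxLW : ∀ w : W, xL (algebraMap W L w) = WittVector.constantCoeff (algebraMap W W w) := by
    intro w
    rw [IsScalarTower.algebraMap_apply W A L, hxL, hx, Algebra.algebraMap_self, RingHom.id_apply]
  obtain ⟨D, hDmul, hDW, a₁, ha₁⟩ := exists_pointDerivation_ne_zero (R := W) (S := L) n hn xL
  have hunc := not_countable_lifts_wittVector (Λ := W) (A := L) xL hxLW D (fun a b => map_add D a b)
    hDmul hDW ⟨a₁, ha₁⟩
  -- restriction of lifts from the chart to `A` is injective
  intro hc
  apply hunc
  let r : {y : L →ₐ[W] W | ∀ a, (y a).coeff 0 = xL a} →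
      {y : A →ₐ[W] W | ∀ a, (y a).coeff 0 = xbar a} :=
    fun y => ⟨y.1.comp (IsScalarTower.toAlgHom W A L), fun a => by
      change (y.1 (algebraMap A L a)).coeff 0 = xbar a
      rw [y.2, hxL]⟩
  have hr : Function.Injective r := by
    intro y y' h
    apply Subtype.ext
    apply AlgHom.coe_ringHom_injective
    refine IsLocalization.ringHom_ext (Submonoid.powers t) ?_
    have h' := congrArg (fun z => (z.1 : A →ₐ[W] W)) h
    exact congrArg (fun f : A →ₐ[W] W => (f : A →+* W)) h'
  haveI : Countable {y : A →ₐ[W] W | ∀ a, (y a).coeff 0 = xbar a} := hc.to_subtype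
  haveI : Countable {y : L →ₐ[W] W | ∀ a, (y a).coeff 0 = xL a} := hr.countable
  exact Set.to_countable _

end Literature.RingTheory.CompleteLocalRings

end
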